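import Summits.HodgeConjecture.HodgeConjecture.Theses.GaloisSieve
import Literature.AlgebraicGeometry.HodgeTheory.ComplexConjugationHolds

/-!
# Route GaloisSieve — `FermatHodgeModels` (support item stmt-HodgeConjecture-14568)

Hodge models of the Fermat varieties: a special case of the tree's DISCHARGED named fact
`nonempty_hodgeModel_holds` (every smooth projective complex variety has a Hodge model: GAGA
analytification, the de Rham theorem, the Hodge decomposition of compact Kähler manifolds).  The
Fermat and degree hypotheses are idle.  No named-fact hypothesis, no sorry.
-/

-- `Summit.HodgeConjecture.HodgeConjecture.Theorems` is the mandated namespace (single-problem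
-- summit: Problem = Summit), which `linter.dupNamespace` flags on every declaration; the lakefile
-- turns the linter off tree-wide (weak option), restated here so stand-alone elaboration is
-- warning-free too.
set_option linter.dupNamespace false

namespace Summit.HodgeConjecture.HodgeConjecture.Theorems

/-- **Item stmt-HodgeConjecture-14568 (`FermatHodgeModels`), route `GaloisSieve`**:
`nonempty_hodgeModel_holds` on the smooth projective variety at hand. [cite: SerreGAGA1956, n° 12 Thm. 1]
[cite: VoisinHodgeI2002, Thm. 6.18] -/
theorem galoisSieve_fermatHodgeModels_proof :
    Summit.HodgeConjecture.HodgeConjecture.Theses.GaloisSieve.FermatHodgeModels :=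
  fun _n _m _X _hm _hF hX ↦ Literature.AlgebraicGeometry.HodgeTheory.nonempty_hodgeModel_holds hX

end Summit.HodgeConjecture.HodgeConjecture.Theorems
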